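import Literature.IUT.LogVolume.InitialThetaDataVolumeDivisibility
import HarnessLib

/-!
# Every bad place of `K = F(E_F[l])` is RAMIFIED, with `l ∣ e(w | v)` and `e(w | p) ≥ l ≥ 5`
# ([IUTchI] Def. 3.1 (c) + Ex. 3.2 (iv); proof-only sequel of `InitialThetaDataVolumeDivisibility.lean`)

Mochizuki, *Inter-universal Teichmüller theory I*, RIMS manuscript (May 2020), Def. 3.1 (c) (kurims p. 62: "`l` is
prime to … the orders of the `q`-parameters of `E_F`") and Example 3.2 (iv) (p. 71: "`q_v` admits a `2l`-th root in
… `𝒪^▷_{K_v̲}`"). abc-iut cell, WAVE-5 prover seat abc-iut-w5-d009 (gen 7); kernel INPUT for the C lead's question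
C-R19 (Q1) (HOME/STATUS 2026-08-26T09:44:14Z: "does the case-A [unramified bad place] refutation apply at ANY bad place
of the `K`-level genuine datum? — my reading: NO, every bad place of `K` is ramified over its prime").

THE POINT. At a place `w` of `K` over `v ∈ 𝕍(F)^bad`, `−ord_w(j_E) = e(w|v)·ord_v(q_v)` (Mathlib `valuation_liesOver` and
Silverman AEC VII.5.1 (b) at the multiplicative place `v`), and `2l ∣ −ord_w(j_E)`
(`ThetaData.two_mul_l_dvd_neg_ord_j_of_under_mem_VFbad`, this seat's p434890 — [IUTchI] Ex. 3.2 (iv) valuation half at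
every `w`). Since Def. 3.1 (c) makes `l` COPRIME to `ord_v(q_v)` (`InitialThetaData.l_coprime_qParamOrd`), the prime
`l` divides the relative ramification index `e(w|v)`; in particular `e(w|v) ≥ l ≥ 5`, `e(w|p) = e(v|p)·e(w|v)` is
divisible by `l`, and NO bad place of `K` is unramified over `F`, let alone over `ℚ`. (Classically: `K_w ⊇ F_v(q_v^{1/l})`
is totally ramified of degree `l` over `F_v` when `l ∤ ord_v(q_v)`; here obtained from the typed data without Tate
uniformisation.)

Results (namespace `Literature.IUT.LogVolume.ThetaData`; `D : InitialThetaData F K F̄ E l Pb`, `w` a finite place of `K`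
with `FinitePlace.mk (w.under (𝓞 F)) ∈ D.VFbad`):
* `neg_ord_j_eq_ramificationIdx_mul_qParamOrd_of_under_mem_VFbad` — `−ord_w(j_E) = e(w|v)·ord_v(q_v)`;
* **`l_dvd_ramificationIdx_of_under_mem_VFbad`** — `l ∣ e(w|v)`;
* `l_le_ramificationIdx_of_under_mem_VFbad`, `five_le_ramificationIdx_of_under_mem_VFbad`, `one_lt_…` — `e(w|v) ≥ l ≥ 5 > 1`:
  `w` is RAMIFIED over `F`;
* **`l_dvd_absRamificationIdx_of_under_mem_VFbad`** — `l ∣ e(w|p)` (`= w.asIdeal.ramificationIdx ℤ`), and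
  `five_le_absRamificationIdx_of_under_mem_VFbad`, `one_lt_absRamificationIdx_of_under_mem_VFbad` — `w` is ramified over `ℚ`
  (so the "odd UNRAMIFIED bad place" configuration — case A of the branch-C hull-line analysis — is EMPTY at `K`-level
  genuine data; every bad place of `K` falls in the ramified case).

PROOF-ONLY (0 `def`, 0 new `Prop`); classical valuation theory on the cell's typed Def. 3.1; nothing here bears on
[IUTchIII] Cor. 3.12 and no side is taken on any author. [cite: Mochizuki2012, IUTchI Def. 3.1 (c) p. 62; Ex. 3.2 (iv) p. 71]
[cite: NeukirchANT1999, Ch. II Prop. (6.8)] [claim: Mochizuki2012, status: disputed] for every IUT quotation.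
-/

noncomputable section

open scoped Classical

namespace Literature.IUT.LogVolume

namespace ThetaData

open Literature.IUT.HodgeTheaters NumberField IsDedekindDomain WeierstrassCurve

variable {F K Fbar : Type} [Field F] [NumberField F] [Field K] [NumberField K] [Algebra F K]
  [Field Fbar] [Algebra F Fbar] [Algebra K Fbar] {E : WeierstrassCurve F} [E.IsElliptic] {l : ℕ}
  {Pb : BadPlacePredicates K} (D : InitialThetaData F K Fbar E l Pb)

omit [NumberField F] [NumberField K] in
/-- The place of `F` below `w` lies below `w` (by definition of `under`). [cite: NeukirchANT1999, Ch. I §8] -/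
private theorem liesOver_under' (w : HeightOneSpectrum (𝓞 K)) :
    w.asIdeal.LiesOver (w.under (𝓞 F)).asIdeal := ⟨rfl⟩

/-- **`−ord_w(j_E) = e(w|v) · ord_v(q_v)`** at a place `w` of `K` over `v = w ∩ 𝓞_F ∈ 𝕍(F)^bad`: `ord_w(j_E) = e(w|v)·ord_v(j_E)`
(Mathlib `valuation_liesOver`) and `−ord_v(j_E) = ord_v(Δ_min) = ord_v(q_v)` at the multiplicative place `v` (Silverman AEC
VII.5.1 (b), the tree's `log_valuation_j_eq_ordMinimalDiscriminant_of_hasMultiplicativeReductionAt`; `qParamOrd := ord_v(Δ_min)`,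
abc-iut-L5-t2). [cite: Mochizuki2012, IUTchI Def. 3.1 (c) p. 62] -/
theorem neg_ord_j_eq_ramificationIdx_mul_qParamOrd_of_under_mem_VFbad {w : HeightOneSpectrum (𝓞 K)}
    (hw : FinitePlace.mk (w.under (𝓞 F)) ∈ D.VFbad) :
    -ord K w (algebraMap F K E.j) =
      (Ideal.ramificationIdx' (w.under (𝓞 F)).asIdeal w.asIdeal : ℤ) * qParamOrd E (w.under (𝓞 F)) := by
  haveI := liesOver_under' (F := F) w
  have hmult : E.HasMultiplicativeReductionAt (w.under (𝓞 F)) :=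
    hasMultiplicativeReductionAt_under_of_mem_VFbad D hw
  have hj := E.log_valuation_j_eq_ordMinimalDiscriminant_of_hasMultiplicativeReductionAt (w.under (𝓞 F)) hmult
  unfold ord qParamOrd
  rw [← IsDedekindDomain.HeightOneSpectrum.valuation_liesOver K (w.under (𝓞 F)) w E.j, WithZero.log_pow, ← hj]
  ring

/-- **`l ∣ e(w|v)`** for every place `w` of `K` over `v ∈ 𝕍(F)^bad`: `2l ∣ −ord_w(j_E) = e(w|v)·ord_v(q_v)` (Ex. 3.2 (iv),
`two_mul_l_dvd_neg_ord_j_of_under_mem_VFbad`) while `l` is prime to `ord_v(q_v)` (Def. 3.1 (c), `l_coprime_qParamOrd`).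
[cite: Mochizuki2012, IUTchI Def. 3.1 (c) p. 62; Ex. 3.2 (iv) p. 71] -/
theorem l_dvd_ramificationIdx_of_under_mem_VFbad {w : HeightOneSpectrum (𝓞 K)}
    (hw : FinitePlace.mk (w.under (𝓞 F)) ∈ D.VFbad) :
    l ∣ Ideal.ramificationIdx' (w.under (𝓞 F)).asIdeal w.asIdeal := by
  have hcop : l.Coprime (qParamOrd E (w.under (𝓞 F))) := by
    have h := D.l_coprime_qParamOrd (FinitePlace.mk (w.under (𝓞 F))) hw
    rwa [FinitePlace.maximalIdeal_mk] at h
  have h2l := two_mul_l_dvd_neg_ord_j_of_under_mem_VFbad D hw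
  rw [neg_ord_j_eq_ramificationIdx_mul_qParamOrd_of_under_mem_VFbad D hw] at h2l
  have hl : (l : ℤ) ∣ (Ideal.ramificationIdx' (w.under (𝓞 F)).asIdeal w.asIdeal : ℤ) * qParamOrd E (w.under (𝓞 F)) :=
    (dvd_mul_left (l : ℤ) 2).trans h2l
  have hnat : l ∣ Ideal.ramificationIdx' (w.under (𝓞 F)).asIdeal w.asIdeal * qParamOrd E (w.under (𝓞 F)) := by
    exact_mod_cast hl
  exact hcop.dvd_of_dvd_mul_right hnat

/-- **`l ≤ e(w|v)`**: the relative ramification index of a bad place of `K` over `F` is at least `l`.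
[cite: Mochizuki2012, IUTchI Ex. 3.2 (iv) p. 71] -/
theorem l_le_ramificationIdx_of_under_mem_VFbad {w : HeightOneSpectrum (𝓞 K)}
    (hw : FinitePlace.mk (w.under (𝓞 F)) ∈ D.VFbad) :
    l ≤ Ideal.ramificationIdx' (w.under (𝓞 F)).asIdeal w.asIdeal := by
  haveI := liesOver_under' (F := F) w
  exact Nat.le_of_dvd (Nat.pos_of_ne_zero
    (Ideal.IsDedekindDomain.ramificationIdx'_ne_zero_of_liesOver w.asIdeal (w.under (𝓞 F)).ne_bot))
    (l_dvd_ramificationIdx_of_under_mem_VFbad D hw)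

/-- **`e(w|v) ≥ 5`** (`l ≥ 5`, Def. 3.1 (c)). [cite: Mochizuki2012, IUTchI Def. 3.1 (c) p. 62] -/
theorem five_le_ramificationIdx_of_under_mem_VFbad {w : HeightOneSpectrum (𝓞 K)}
    (hw : FinitePlace.mk (w.under (𝓞 F)) ∈ D.VFbad) :
    5 ≤ Ideal.ramificationIdx' (w.under (𝓞 F)).asIdeal w.asIdeal :=
  D.five_le_l.trans (l_le_ramificationIdx_of_under_mem_VFbad D hw)

/-- **Every bad place of `K` is RAMIFIED over `F`**: `e(w|v) > 1`. [cite: Mochizuki2012, IUTchI Ex. 3.2 (iv) p. 71] -/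
theorem one_lt_ramificationIdx_of_under_mem_VFbad {w : HeightOneSpectrum (𝓞 K)}
    (hw : FinitePlace.mk (w.under (𝓞 F)) ∈ D.VFbad) :
    1 < Ideal.ramificationIdx' (w.under (𝓞 F)).asIdeal w.asIdeal :=
  lt_of_lt_of_le (by norm_num) (five_le_ramificationIdx_of_under_mem_VFbad D hw)

/-! ## Absolute ramification: `e(w | p) = e(v | p) · e(w | v)` is divisible by `l` -/

/-- `e(w|p) = e(v|p)·e(w|v)` in the tower `ℤ ⊆ 𝓞_F ⊆ 𝓞_K` (Mathlib `ramificationIdx'_algebra_tower'`), with `p` the residue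
characteristic of `v = w ∩ 𝓞_F`, `e(v|p) =` c312-3's `ramIdx F v`, `e(w|p) =` Mathlib's `w.asIdeal.ramificationIdx ℤ`.
[cite: NeukirchANT1999, Ch. II Prop. (6.8)] -/
theorem absRamificationIdx_eq_ramIdx_mul (w : HeightOneSpectrum (𝓞 K)) :
    w.asIdeal.ramificationIdx ℤ =
      ramIdx F (w.under (𝓞 F)) * Ideal.ramificationIdx' (w.under (𝓞 F)).asIdeal w.asIdeal := by
  haveI := liesOver_under' (F := F) w
  set v := w.under (𝓞 F) with hv
  haveI : w.asIdeal.LiesOver (Ideal.span {(residueChar F v : ℤ)}) := Ideal.LiesOver.trans w.asIdeal v.asIdeal _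
  have hp : Ideal.span {(residueChar F v : ℤ)} ≠ ⊥ := by
    rw [Ne, Ideal.span_singleton_eq_bot]
    exact_mod_cast (residueChar_prime F v).ne_zero
  rw [← Ideal.ramificationIdx'_eq_ramificationIdx (Ideal.span {(residueChar F v : ℤ)}) w.asIdeal hp]
  unfold ramIdx
  exact Ideal.ramificationIdx'_algebra_tower' _ _ _

/-- **`l ∣ e(w|p)`**: the ABSOLUTE ramification index of every bad place of `K` is divisible by `l`.
[cite: Mochizuki2012, IUTchI Ex. 3.2 (iv) p. 71] -/
theorem l_dvd_absRamificationIdx_of_under_mem_VFbad {w : HeightOneSpectrum (𝓞 K)}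
    (hw : FinitePlace.mk (w.under (𝓞 F)) ∈ D.VFbad) : l ∣ w.asIdeal.ramificationIdx ℤ := by
  rw [absRamificationIdx_eq_ramIdx_mul (F := F) w]
  exact (l_dvd_ramificationIdx_of_under_mem_VFbad D hw).mul_left _

/-- **`e(w|p) ≥ 5`** at every bad place of `K`. [cite: Mochizuki2012, IUTchI Def. 3.1 (c) p. 62] -/
theorem five_le_absRamificationIdx_of_under_mem_VFbad {w : HeightOneSpectrum (𝓞 K)}
    (hw : FinitePlace.mk (w.under (𝓞 F)) ∈ D.VFbad) : 5 ≤ w.asIdeal.ramificationIdx ℤ := by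
  have hpos : 0 < w.asIdeal.ramificationIdx ℤ := Ideal.ramificationIdx_pos _ _
  exact D.five_le_l.trans (Nat.le_of_dvd hpos (l_dvd_absRamificationIdx_of_under_mem_VFbad D hw))

/-- **No bad place of `K` is absolutely unramified**: `e(w|p) > 1` — the "odd unramified bad place" configuration (case A
of the branch-C hull-line analysis at the `F`-presentation) is EMPTY over the print-faithful field `K` of an initial
Θ-datum. [cite: Mochizuki2012, IUTchI Ex. 3.2 (iv) p. 71] -/
theorem one_lt_absRamificationIdx_of_under_mem_VFbad {w : HeightOneSpectrum (𝓞 K)}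
    (hw : FinitePlace.mk (w.under (𝓞 F)) ∈ D.VFbad) : 1 < w.asIdeal.ramificationIdx ℤ :=
  lt_of_lt_of_le (by norm_num) (five_le_absRamificationIdx_of_under_mem_VFbad D hw)

/-- The same in the negative form "`w` is not unramified over `ℚ`": `e(w|p) ≠ 1`.
[cite: Mochizuki2012, IUTchI Ex. 3.2 (iv) p. 71] -/
theorem absRamificationIdx_ne_one_of_under_mem_VFbad {w : HeightOneSpectrum (𝓞 K)}
    (hw : FinitePlace.mk (w.under (𝓞 F)) ∈ D.VFbad) : w.asIdeal.ramificationIdx ℤ ≠ 1 :=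
  (one_lt_absRamificationIdx_of_under_mem_VFbad D hw).ne'

end ThetaData

end Literature.IUT.LogVolume

end
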